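import Summits.HodgeConjecture.HodgeConjecture.Theorems.PadicSemiregularLiftFormalLiftingFromClassLifting

/-!
# `FormalLiftingFromClassLiftingOfHu` (stmt-HodgeConjecture-15976) · closing theorem

The glue item of route `HodgeConjecture/PadicSemiregularLift` (route-choice rewiring, planners
rchoice-1367de67 / rchoice-f3ade33a, route file rev 21):
`HuInfinitesimalKZero → HodgeDeRhamDegeneration → FormalLiftingFromClassLifting`.

The three route decls are, by construction, `δ`-equal to the Literature constants
(`HuInfinitesimalKZero` unfolds to `KTheory.HuKZeroLiftingCriterion ∧ KTheory.HuKZeroKernelPresentation`,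
`HodgeDeRhamDegeneration` to `Crystalline.HodgeDeRhamDegeneratesModTorsion`), so the glue is the landed
conditional closure of the crux P1a,
`FormalLiftingFromClassLifting.formalLiftingFromClassLifting_of_namedFacts` (p118963: step class lifting
from the two Hu claims via `HuLine.stepClassLifting_of_hu`, the lattice lemmas (S)/(T) from Deligne's
degeneration via `Lattice.oddReductionsSurjective_of_hdeg` / `Lattice.evenFamiliesTorsionFree_of_hdeg`, and
the tower climb `Glue.liftsFormally_of_stepClassLifting`), with its three hypotheses supplied by the two
antecedents of the glue. Nothing is assumed here: the Hu claims and the degeneration are ANTECEDENTS of the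
implication proved, not hypotheses of a conditional result.
-/

set_option linter.dupNamespace false

namespace Summit.HodgeConjecture.HodgeConjecture.Theorems

/-- **The glue `FormalLiftingFromClassLiftingOfHu` of route `PadicSemiregularLift`.** Hu's two `K₀`-claims
(item `HuInfinitesimalKZero`: the level-wise lifting criterion, arXiv:2507.12458 Thm. 1.2 / Prop. 11.1 (i),
and the kernel presentation, Cor. 10.5 (i) / Prop. 9.6 (ii)) and Deligne's degeneration of Hodge–de Rham
modulo torsion for smooth proper `𝒳/W(k)` (item `HodgeDeRhamDegeneration`, Deligne 1968 Thm. 5.5 (ii)) imply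
the crux P1a `FormalLiftingFromClassLifting`: `formalLiftingFromClassLifting_of_namedFacts h.1 h.2 hdeg`, the
route decls being `δ`-equal to the Literature statements. [cite: Hu2025TruncatedWitt, Thm. 1.2, Cor. 10.5 (i)]
[cite: Deligne1968, Thm. 5.5 (ii)] -/
theorem formalLiftingFromClassLiftingOfHu_proof :
    Summit.HodgeConjecture.HodgeConjecture.Theses.PadicSemiregularLift.FormalLiftingFromClassLiftingOfHu :=
  fun h hdeg =>
    FormalLiftingFromClassLifting.formalLiftingFromClassLifting_of_namedFacts h.1 h.2 hdeg

end Summit.HodgeConjecture.HodgeConjecture.Theorems
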